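import Literature.MathematicalPhysics.QuantumFieldTheory.VillainRenormalisation
import Literature.MathematicalPhysics.QuantumFieldTheory.VillainPhaseBound
import Literature.Probability.LatticeModels.FrohlichSpencerCosineLowerBound
import HarnessLib

/-!
# Jensen's inequality for one term of the Villain monopole gas (Fröhlich–Spencer §2.9–2.10,
# (2.74)–(2.81), (2.87))

Support file for the Coulomb-gas (monopole) representation of four-dimensional `U(1)` lattice gauge
theory with the Villain action (proof programme of the named fact
`Literature.MathematicalPhysics.QuantumFieldTheory.FrohlichSpencerU1PerimeterLawD4` and of its
corollary `Literature.Barriers.QuantumFields.AbelianDeconfinementD4`). For one term of the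
closed-ensemble expansion of the Wilson numerator — a 1-ensemble `𝒩` of the coarse adjacency with
activities `0 ≤ K_ρ ≤ 3^{N₁(supp ρ)} ∏_{b} z_{κ_b}`, `z_k = 2^{k+1}`, vanishing on non-closed
densities (`VillainGasEnsembles`) — we renormalise (`VillainRenormalisation`), bound the
renormalised activities for `β ≥ β₀` by `z̄_ρ ≤ e^{-10 ‖ρ‖₂²}` (FS82 (2.74)–(2.77)), and apply the
shifted-cosine lower bound of `FrohlichSpencerCosineLowerBound` (FS82 (2.79)–(2.80), Jensen) with
the even finite measure `e^{-½aᵀPa} da` and the phase representatives of `VillainPhaseBound`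
(FS82 (2.81)–(2.87)):

* `zAct k = 2^{k+1}`, `betaJ` (the threshold `β₀`), `activity_le_exp` (`K_ρ ≤ e^{C_K ‖ρ‖₂²}`),
  `renormActivity_le` (`z̄_ρ ≤ e^{-10‖ρ‖₂²} ≤ 1/2`);
* `measurePreserving_neg_withDensity_auxGauss` (the Gaussian measure is even);
* **`term_lower_bound`**:
  `e^{-(c_J (ε,ε) + C₀)} ∫ e^{-½aᵀPa} ∏_ρ(1 + K_ρ cos ρ(a)) da ≤ ∫ e^{-½aᵀPa} ∏_ρ(1 + K_ρ cos ρ(a + ψ)) da`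
  and the unshifted integral is non-negative.

Everything is proved; no named fact is introduced.

## References

* J. Fröhlich, T. Spencer, Comm. Math. Phys. 83 (1982) 411–454, §2.9 (2.74)–(2.77), §2.10
  (2.78)–(2.81), (2.87)–(2.88). [FrohlichSpencerCMP1982]
-/

noncomputable section

open Finset Function Matrix MeasureTheory
open scoped Real ENNReal
open Literature.Probability.LatticeModels
open Literature.Probability.LatticeModels.GaussianCoord (lin measurable_lin)
open Literature.Probability.LatticeModels.EnsembleExpansion (phase ensembleProd IsOneEnsemble IsAdjConnected nbhd
  card_nbhd_le gammaFS gammaFS_nonneg gammaFS_le exp_mul_integral_prod_le)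

namespace Literature.MathematicalPhysics.QuantumFieldTheory

namespace VillainAngle

open AxialGauge LatticeForm LatticeChain VillainFibre

variable {n : ℕ}

/-! ### The activities and the threshold -/

/-- **The activities** `z_k = 2^{k+1}` (so that `u_k = 2/z_k = 2^{-k}` sums to one over `k ≥ 1`;
FS82 leave the choice of `z_q` with `∑ 2 z_q⁻¹ = 1` open). [cite: FrohlichSpencerCMP1982, §2.6 (2.38)] -/
def zAct (k : ℕ) : ℝ := 2 ^ (k + 1)

/-- `z_k > 0`. [folklore] -/
theorem zAct_pos (k : ℕ) : 0 < zAct k := by unfold zAct; positivity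

/-- The growth constant of the bare activities: `K_ρ ≤ e^{C_K ‖ρ‖₂²}`. [folklore] -/
def CK : ℝ := (degC 4 + 1) * Real.log 3 + 2 * Real.log 2

/-- `0 ≤ C_K`. [folklore] -/
theorem CK_nonneg : 0 ≤ CK := by
  unfold CK
  have h3 : 0 ≤ Real.log 3 := Real.log_nonneg (by norm_num)
  have h2 : 0 ≤ Real.log 2 := Real.log_nonneg (by norm_num)
  positivity

/-- The decay rate of the renormalisation per unit of `β ‖ρ‖₂²`. [folklore] -/
def cR : ℝ := 2 * π ^ 2 / (lamV 4 * (degC 4 + 1))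

/-- `0 < c_R`. [folklore] -/
theorem cR_pos : 0 < cR := by
  unfold cR lamV degC
  positivity

/-- **The threshold** `β₀ = (C_K + 10)/c_R` beyond which the renormalised activities are
`≤ e^{-10 ‖ρ‖₂²}`. [cite: FrohlichSpencerCMP1982, §2.9 (2.76)–(2.77)] -/
def betaJ : ℝ := (CK + 10) / cR

/-- `0 < β₀`. [folklore] -/
theorem betaJ_pos : 0 < betaJ := by
  unfold betaJ
  exact div_pos (by linarith [CK_nonneg]) cR_pos

/-! ### Bare and renormalised activities -/

/-- `‖ρ‖₂² = ∑_b κ_b²` when `|ρ_b| = κ_b` on the support. [folklore] -/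
theorem wt_eq_sum_kappa {κ : CIdx 4 n → ℕ} {ρ : CIdx 4 n →₀ ℤ} (h : ∀ b ∈ ρ.support, |ρ b| = κ b) :
    wt ρ = ∑ b ∈ ρ.support, ((κ b : ℝ)) ^ 2 := by
  refine Finset.sum_congr rfl fun b hb => ?_
  rw [← sq_abs, ← Int.cast_abs, h b hb]
  simp

/-- `1 ≤ ‖ρ‖₂²` for `ρ ≠ 0`. [folklore] -/
theorem one_le_wt {ρ : CIdx 4 n →₀ ℤ} (hρ : ρ ≠ 0) : 1 ≤ wt ρ := by
  have h := card_le_wt ρ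
  have h1 : (1 : ℝ) ≤ ρ.support.card := by
    exact_mod_cast Finset.card_pos.2 (Finsupp.support_nonempty_iff.2 hρ)
  linarith

/-- **The bare activities grow at most exponentially in `‖ρ‖₂²`** (FS82 (2.74)–(2.75):
`N₁(supp ρ) ≤ (Δ+1) L(ρ)`, `∏ z_{κ_b} = 2^{∑(κ_b+1)} ≤ 4^{‖ρ‖₂²}`). [cite: FrohlichSpencerCMP1982, §2.9 (2.74)–(2.75)] -/
theorem activity_le_exp {κ : CIdx 4 n → ℕ} {ρ : CIdx 4 n →₀ ℤ} (hκ : ∀ b ∈ ρ.support, |ρ b| = κ b)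
    {Kρ : ℝ} (hK : Kρ ≤ 3 ^ (nbhd adjC Finset.univ ρ.support).card * ∏ b ∈ ρ.support, zAct (κ b)) :
    Kρ ≤ Real.exp (CK * wt ρ) := by
  classical
  have hw0 : 0 ≤ wt ρ := Finset.sum_nonneg fun _ _ => sq_nonneg _
  -- `N₁ ≤ (Δ+1) #supp ≤ (Δ+1) w`
  have hN : ((nbhd adjC Finset.univ ρ.support).card : ℝ) ≤ (degC 4 + 1) * wt ρ := by
    have h1 := card_nbhd_le adjC Finset.univ ρ.support (degC 4) (fun a _ => card_filter_adjC_le a)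
    calc ((nbhd adjC Finset.univ ρ.support).card : ℝ) ≤ ((degC 4 + 1) * ρ.support.card : ℕ) := by
          exact_mod_cast h1
      _ = (degC 4 + 1) * (ρ.support.card : ℝ) := by push_cast; ring
      _ ≤ (degC 4 + 1) * wt ρ := mul_le_mul_of_nonneg_left (card_le_wt ρ) (by positivity)
  -- `∑ (κ_b + 1) ≤ 2 w`
  have hS : ((∑ b ∈ ρ.support, (κ b + 1) : ℕ) : ℝ) ≤ 2 * wt ρ := by
    rw [wt_eq_sum_kappa hκ, Finset.mul_sum]
    push_cast
    refine Finset.sum_le_sum fun b hb => ?_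
    have h1 : (1 : ℝ) ≤ κ b := by
      have := hκ b hb
      have h2 : (1 : ℤ) ≤ |ρ b| := Int.one_le_abs (Finsupp.mem_support_iff.1 hb)
      rw [this] at h2
      exact_mod_cast h2
    nlinarith
  have h3 : (3 : ℝ) ^ (nbhd adjC Finset.univ ρ.support).card ≤ Real.exp ((degC 4 + 1) * Real.log 3 * wt ρ) := by
    rw [← Real.rpow_natCast, Real.rpow_def_of_pos (by norm_num : (0 : ℝ) < 3)]
    refine Real.exp_le_exp.2 ?_
    have hl : 0 ≤ Real.log 3 := Real.log_nonneg (by norm_num)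
    nlinarith
  have h2 : ∏ b ∈ ρ.support, zAct (κ b) ≤ Real.exp (2 * Real.log 2 * wt ρ) := by
    have hprod : ∏ b ∈ ρ.support, zAct (κ b) = (2 : ℝ) ^ (∑ b ∈ ρ.support, (κ b + 1)) := by
      rw [← Finset.prod_pow_eq_pow_sum]; rfl
    rw [hprod, ← Real.rpow_natCast, Real.rpow_def_of_pos (by norm_num : (0 : ℝ) < 2)]
    refine Real.exp_le_exp.2 ?_
    have hl : 0 ≤ Real.log 2 := Real.log_nonneg (by norm_num)
    nlinarith
  calc Kρ ≤ 3 ^ (nbhd adjC Finset.univ ρ.support).card * ∏ b ∈ ρ.support, zAct (κ b) := hK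
    _ ≤ Real.exp ((degC 4 + 1) * Real.log 3 * wt ρ) * Real.exp (2 * Real.log 2 * wt ρ) :=
        mul_le_mul h3 h2 (Finset.prod_nonneg fun _ _ => (zAct_pos _).le) (Real.exp_pos _).le
    _ = Real.exp (CK * wt ρ) := by rw [← Real.exp_add, CK]; ring_nf

/-- **The renormalised activities are small for `β ≥ β₀`** (FS82 (2.76)–(2.77)):
`z̄_ρ ≤ K_ρ e^{-c_R β ‖ρ‖₂²} ≤ e^{-10 ‖ρ‖₂²}`. [cite: FrohlichSpencerCMP1982, §2.9 (2.76)–(2.77)] -/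
theorem renormActivity_le {β : ℝ} (hβ : betaJ ≤ β) {ρ : CIdx 4 n →₀ ℤ} {Kρ zρ : ℝ}
    (hK : Kρ ≤ Real.exp (CK * wt ρ))
    (hz : zρ ≤ Kρ * Real.exp (-(2 * π ^ 2 * β / lamV 4) *
      (∑ c ∈ ρ.support, ((ρ c : ℝ)) ^ 2) / (degC 4 + 1))) :
    zρ ≤ Real.exp (-(10 * wt ρ)) := by
  have hw0 : 0 ≤ wt ρ := Finset.sum_nonneg fun _ _ => sq_nonneg _
  have hexp : Real.exp (-(2 * π ^ 2 * β / lamV 4) * (∑ c ∈ ρ.support, ((ρ c : ℝ)) ^ 2) / (degC 4 + 1)) =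
      Real.exp (-(cR * β * wt ρ)) := by
    congr 1
    rw [cR, wt]
    have h1 : (0 : ℝ) < lamV 4 := by unfold lamV; positivity
    have h2 : (0 : ℝ) < degC 4 + 1 := by positivity
    field_simp
  rw [hexp] at hz
  have hβ' : CK + 10 ≤ cR * β := by
    rw [betaJ, div_le_iff₀ cR_pos] at hβ
    linarith
  calc zρ ≤ Kρ * Real.exp (-(cR * β * wt ρ)) := hz
    _ ≤ Real.exp (CK * wt ρ) * Real.exp (-(cR * β * wt ρ)) :=
        mul_le_mul_of_nonneg_right hK (Real.exp_pos _).le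
    _ = Real.exp ((CK - cR * β) * wt ρ) := by rw [← Real.exp_add]; ring_nf
    _ ≤ Real.exp (-(10 * wt ρ)) := Real.exp_le_exp.2 (by nlinarith)

/-- `e^{-10 w} ≤ 1/2` for `w ≥ 1`. [folklore] -/
theorem exp_neg_ten_mul_le {w : ℝ} (hw : 1 ≤ w) : Real.exp (-(10 * w)) ≤ 1 / 2 := by
  have h1 : Real.exp (-(10 * w)) ≤ Real.exp (-1) := Real.exp_le_exp.2 (by linarith)
  have h2 : (2 : ℝ) ≤ Real.exp 1 := by have := Real.add_one_le_exp (1 : ℝ); linarith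
  have h3 : Real.exp (-1) ≤ 1 / 2 := by
    rw [Real.exp_neg, inv_le_comm₀ (Real.exp_pos _) (by norm_num)]
    simpa using h2
  exact h1.trans h3

/-! ### The even Gaussian measure -/

/-- The Gaussian weight is even. [folklore] -/
theorem auxGauss_neg (β : ℝ) (a : CIdx 4 n → ℝ) : auxGauss β (-a) = auxGauss β a := by
  simp [auxGauss, Matrix.mulVec_neg, dotProduct_neg, neg_dotProduct]

/-- The finite measure `e^{-½aᵀPa} da`. [folklore] -/
def gaussMeasure (β : ℝ) : Measure (CIdx 4 n → ℝ) :=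
  volume.withDensity fun a => ENNReal.ofReal (auxGauss β a)

/-- `e^{-½aᵀPa} da` is finite. [folklore] -/
instance isFiniteMeasure_gaussMeasure {β : ℝ} [Fact (0 < β)] : IsFiniteMeasure (gaussMeasure (n := n) β) :=
  isFiniteMeasure_withDensity_ofReal (integrable_auxGauss (d := 4) (n := n) Fact.out).hasFiniteIntegral

/-- **`a ↦ -a` preserves the Gaussian measure.** [folklore] -/
theorem measurePreserving_neg_gaussMeasure (β : ℝ) :
    MeasurePreserving (Neg.neg : (CIdx 4 n → ℝ) → (CIdx 4 n → ℝ)) (gaussMeasure β) (gaussMeasure β) := by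
  have hvol : MeasurePreserving (Neg.neg : (CIdx 4 n → ℝ) → (CIdx 4 n → ℝ)) volume volume :=
    ⟨measurable_neg, Measure.map_neg_eq_self _⟩
  have hmeas : Measurable fun a : CIdx 4 n → ℝ => ENNReal.ofReal (auxGauss β a) :=
    ENNReal.measurable_ofReal.comp (continuous_auxGauss β).measurable
  refine ⟨measurable_neg, ?_⟩
  ext s hs
  rw [Measure.map_apply measurable_neg hs, gaussMeasure, withDensity_apply _ (measurable_neg hs),
    withDensity_apply _ hs]
  calc ∫⁻ a in Neg.neg ⁻¹' s, ENNReal.ofReal (auxGauss β a)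
      = ∫⁻ a in Neg.neg ⁻¹' s, ENNReal.ofReal (auxGauss β (-a)) := by simp_rw [auxGauss_neg]
    _ = ∫⁻ a in s, ENNReal.ofReal (auxGauss β a) := hvol.setLIntegral_comp_preimage hs hmeas

/-- Integrals against the Gaussian measure are weighted Lebesgue integrals. [folklore] -/
theorem integral_gaussMeasure (β : ℝ) (F : (CIdx 4 n → ℝ) → ℝ) :
    ∫ a, F a ∂gaussMeasure β = ∫ a, auxGauss β a * F a := by
  rw [gaussMeasure]
  have hmeas : Measurable fun a : CIdx 4 n → ℝ => (auxGauss β a).toNNReal :=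
    measurable_real_toNNReal.comp (continuous_auxGauss β).measurable
  have h := integral_withDensity_eq_integral_smul hmeas F (μ := volume)
  simp only [NNReal.smul_def, smul_eq_mul] at h
  have hcoe : ∀ a : CIdx 4 n → ℝ, ((auxGauss β a).toNNReal : ℝ≥0∞) = ENNReal.ofReal (auxGauss β a) := fun a => rfl
  simp_rw [hcoe] at h
  rw [h]
  refine integral_congr_ae (Filter.Eventually.of_forall fun a => ?_)
  simp only
  rw [Real.coe_toNNReal _ (auxGauss_pos β a).le]

/-- `lin` is odd. [folklore] -/
theorem lin_neg (c a : CIdx 4 n → ℝ) : lin c (-a) = -lin c a := by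
  simp [lin, Finset.sum_neg_distrib, mul_neg]

/-! ### Jensen's inequality for one term -/

/-- **Lower bound on one term of the Wilson numerator (FS82 (2.78)–(2.81), (2.87)).** For
`β ≥ β₀`, a 1-ensemble `𝒩` (coarse adjacency) of non-zero connected densities with
`|ρ_b| = κ_b` on the supports and activities `0 ≤ K_ρ ≤ 3^{N₁(supp ρ)} ∏_b z_{κ_b}` vanishing on the
non-closed densities,
`e^{-(c_J (ε,ε) + C₀)} ∫ e^{-½aᵀPa} ∏_ρ (1 + K_ρ cos ρ(a)) da ≤ ∫ e^{-½aᵀPa} ∏_ρ (1 + K_ρ cos ρ(a + ψ)) da`,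
`ψ = 2π B'⁻¹DS`, and the unshifted integral is non-negative. [cite: FrohlichSpencerCMP1982, §2.10 (2.78)–(2.81), (2.87)] -/
theorem term_lower_bound (hn : 1 ≤ n) {β : ℝ} (hβ : betaJ ≤ β) (S : PIdx 4 n → ℤ) (κ : CIdx 4 n → ℕ)
    (N : Finset (CIdx 4 n →₀ ℤ)) (K : (CIdx 4 n →₀ ℤ) → ℝ) (hens : IsOneEnsemble adjC N)
    (hdens : ∀ ρ ∈ N, ρ ≠ 0 ∧ ∀ b ∈ ρ.support, |ρ b| = κ b)
    (hK : ∀ ρ ∈ N, 0 ≤ K ρ ∧ K ρ ≤ 3 ^ (nbhd adjC Finset.univ ρ.support).card * ∏ b ∈ ρ.support, zAct (κ b) ∧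
      (EInt ρ ≠ 0 → K ρ = 0))
    (hconn : ∀ ρ ∈ N, IsAdjConnected adjC ρ.support) :
    Real.exp (-(cJ * (epsField S ⬝ᵥ epsField S) + C0)) * ∫ a, auxGauss β a * ensembleProd N K a ≤
        ∫ a, auxGauss β a * ensembleProd N K (a + auxShift fun p => (S p : ℝ)) ∧
      0 ≤ ∫ a, auxGauss β a * ensembleProd N K a := by
  classical
  have hβpos : 0 < β := betaJ_pos.trans_le hβ
  haveI : Fact (0 < β) := ⟨hβpos⟩
  set ψ : CIdx 4 n → ℝ := auxShift fun p => (S p : ℝ) with hψ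
  obtain ⟨zR, aR, hzR, hIψ, hI0⟩ := exists_renormalisation hβpos N hens K (fun ρ h => (hK ρ h).1) ψ
  -- the renormalised activities
  have hz10 : ∀ k : ↥N, zR k ≤ Real.exp (-(10 * wt (k : CIdx 4 n →₀ ℤ))) := fun k =>
    renormActivity_le hβ (activity_le_exp (hdens k k.2).2 (hK k k.2).2.1) (hzR k).2
  have hzhalf : ∀ k : ↥N, 0 ≤ zR k ∧ zR k ≤ 1 / 2 := fun k =>
    ⟨(hzR k).1, (hz10 k).trans (exp_neg_ten_mul_le (one_le_wt (hdens k k.2).1))⟩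
  have hzlt : ∀ k ∈ (Finset.univ : Finset ↥N), 0 ≤ zR k ∧ zR k < 1 := fun k _ =>
    ⟨(hzhalf k).1, (hzhalf k).2.trans_lt (by norm_num)⟩
  -- the weights `γ` and the phase loss
  set γ : (CIdx 4 n →₀ ℤ) → ℝ := fun ρ => if h : ρ ∈ N then gammaFS (zR ⟨ρ, h⟩) else 0 with hγdef
  have hγ : ∀ ρ ∈ N, 0 ≤ γ ρ ∧ γ ρ ≤ 7 * Real.exp (-(10 * wt ρ)) := by
    intro ρ hρ
    simp only [hγdef, dif_pos hρ]
    obtain ⟨h0, h1⟩ := hzhalf ⟨ρ, hρ⟩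
    exact ⟨gammaFS_nonneg h0 (h1.trans_lt (by norm_num)),
      (gammaFS_le h0 h1).trans (by linarith [hz10 ⟨ρ, hρ⟩])⟩
  have hγ0 : ∀ ρ ∈ N, ¬IsClosedFlux (⇑ρ) → γ ρ = 0 := by
    intro ρ hρ hncl
    simp only [hγdef, dif_pos hρ]
    have hE : EInt (⇑ρ) ≠ 0 := fun h => hncl ((isClosedFlux_iff_EInt_eq_zero _).2 h)
    have hK0 : K ρ = 0 := (hK ρ hρ).2.2 hE
    have hz0 : zR ⟨ρ, hρ⟩ = 0 := by
      have h1 := (hzR ⟨ρ, hρ⟩).2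
      simp only [hK0, zero_mul] at h1
      exact le_antisymm h1 (hzR ⟨ρ, hρ⟩).1
    rw [hz0]
    simp [gammaFS]
  have hloss := sum_gamma_theta_sq_le hn S N hens (fun ρ h => (hdens ρ h).1) hconn γ hγ hγ0
  have hloss' : ∑ k : ↥N, gammaFS (zR k) * theta hn S k ^ 2 ≤ cJ * (epsField S ⬝ᵥ epsField S) + C0 := by
    rw [← Finset.sum_coe_sort N] at hloss
    refine le_trans (le_of_eq (Finset.sum_congr rfl fun k _ => ?_)) hloss
    simp only [hγdef, dif_pos k.2]
  -- Jensen with the even Gaussian measure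
  have hJ := exp_mul_integral_prod_le (gaussMeasure (n := n) β) (Finset.univ : Finset ↥N) zR
    (fun k => theta hn S k) hzlt (fun k a => lin (aR k) a) (fun k => measurable_lin _)
    measurable_neg neg_involutive (measurePreserving_neg_gaussMeasure β) (fun k a => lin_neg _ _)
  rw [integral_gaussMeasure, integral_gaussMeasure] at hJ
  -- identify the integrals
  have hψ' : ∫ a, auxGauss β a * ensembleProd N K (a + ψ) =
      ∫ a, auxGauss β a * ∏ k : ↥N, (1 + zR k * Real.cos (lin (aR k) a - theta hn S k)) := by
    rw [hIψ]
    refine integral_congr_ae (Filter.Eventually.of_forall fun a => ?_)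
    simp only
    congr 1
    refine Finset.prod_congr rfl fun k _ => ?_
    rw [cos_add_phase_eq hn S]
  have hnonneg : 0 ≤ ∫ a, auxGauss β a * ∏ k : ↥N, (1 + zR k * Real.cos (lin (aR k) a)) := by
    refine integral_nonneg fun a => mul_nonneg (auxGauss_pos β a).le (Finset.prod_nonneg fun k _ => ?_)
    have h1 := Real.neg_one_le_cos (lin (aR k) a)
    have h2 := (hzhalf k).1
    have h3 := (hzhalf k).2
    nlinarith
  refine ⟨?_, by rw [hI0]; exact hnonneg⟩
  rw [hψ', hI0]
  calc Real.exp (-(cJ * (epsField S ⬝ᵥ epsField S) + C0)) *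
        ∫ a, auxGauss β a * ∏ k : ↥N, (1 + zR k * Real.cos (lin (aR k) a))
      ≤ Real.exp (-∑ k : ↥N, gammaFS (zR k) * theta hn S k ^ 2) *
        ∫ a, auxGauss β a * ∏ k : ↥N, (1 + zR k * Real.cos (lin (aR k) a)) :=
        mul_le_mul_of_nonneg_right (Real.exp_le_exp.2 (by linarith)) hnonneg
    _ ≤ ∫ a, auxGauss β a * ∏ k : ↥N, (1 + zR k * Real.cos (lin (aR k) a - theta hn S k)) := hJ

end VillainAngle

end Literature.MathematicalPhysics.QuantumFieldTheory
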